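import Literature.RepresentationTheory.MoeglinVignerasWaldspurger1987.RankOneThetaLiftTwistRigidity
import Literature.RepresentationTheory.MoeglinVignerasWaldspurger1987.RankOneThetaLiftNonvanishingProofs
import Literature.NumberTheory.GelbartRogawski1991.LocalSplittingsDifferByCharacter
import Literature.NumberTheory.Automorphic.Liu2021.LemD1LocalInjectivity
import HarnessLib

/-!
# Twist rigidity of the rank-one theta lift: reduction of the `μ`-clause (row IV-4c3) to ONE splitting and a twist

Topic `RepresentationTheory/MoeglinVignerasWaldspurger1987`; THEOREMS ONLY (no definition, no named fact, no `sorry`).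
Companion of `RankOneThetaLiftTwistRigidity.lean` (the named fact IV-4c3 `rankOne_theta_twist_rigidity`: two splittings
`s₁, s₂` of `U(J)(F_v)` into the local metaplectic group over `ι` whose `χ₁`-, `χ₂`-coinvariant representations
`Θ_{s₁}(χ₁) ≅ Θ_{s₂}(χ₂) ≠ 0` are isomorphic are EQUAL) and of `RankOneThetaLiftSeparation.lean` (B-p13: the `χ`-clause).

WHAT IS PROVED (cell `hodgecm-mathlib`, B-p03's PREP-IV4c3 §1 (r1)–(r4) and §4 milestone M1, second-token piece):

* §1 (generic, namespace `Literature.RepresentationTheory.TwistedCoinv`) **coinvariants of a twist**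
  (`exists_linearEquiv_of_twist`): if `ρW′ h = e h • ρW h`, `χ′ = e · χ` and `ρV′ g = η g • ρV g` (two acting pairs on ONE
  module differing by scalars), the identity of `S` induces `Coinv ρW χ ≃ Coinv ρW′ χ′` intertwining the twist
  `η ⊗ rep χ ρV` with `rep χ′ ρV′` — the tree's `TwistedCoinv.mapEquiv` along `LinearEquiv.refl` plus `mapEquiv_rep`.  In words:
  **`Θ_{η·s}(χ) ≅ η ⊗ Θ_s(χ · η_Z⁻¹)`**, `η_Z = η ∘ (centre)`.
* §2 `areIsomorphicRep_rep_of_eq` — the coinvariant representation built from `ω` only depends on `ω` (transport along an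
  equality of representations; bookkeeping for `ω_{s₂} = η • ω_{s₁}`).
* §3 **`rankOne_theta_twist_rigidity_of_twistRigid`** — the named fact IV-4c3 FOLLOWS from TWIST RIGIDITY FOR ONE SECTION:
  «for every splitting `s` over `ι` with `ω_s` smooth, every character `η` of `U(J)(F_v)` with open kernel and all unitary
  continuous `χ, χ′`: `Θ_s(χ) ≠ 0` and `Θ_s(χ) ≅ η ⊗ Θ_s(χ′)` imply `η = 1`».  Proof: two splittings over `ι` differ by a
  character `η` (`MpPsi.exists_character_of_proj_eq`, implementers of the local Schrödinger model being unique up to scalars,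
  `implementerUniqueUpToScalar_localSchrodinger`), so `ω_{s₂} = η • ω_{s₁}`; `η` has open kernel because both `ω`'s are
  smooth (`isOpen_ker_of_twist_of_isSmoothVector`); `η_Z := η ∘ localCenter` is then a continuous character of the COMPACT
  centre `U(J₁)(F_v) = E_v¹` (non-split `v`), hence unitary, so `χ′ := χ₂ · η_Z⁻¹` is unitary continuous; §1–§2 turn the
  hypothesis `Θ_{s₁}(χ₁) ≅ Θ_{s₂}(χ₂)` into `Θ_{s₁}(χ₁) ≅ η ⊗ Θ_{s₁}(χ′)`; twist rigidity gives `η = 1`, i.e. `s₂ = s₁`.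
  The net content of IV-4c3 is thereby isolated as the separation of determinant twists inside the rank-one packet of
  quasi-split `U(3)` ([GelbartRogawski1990, Prop. 5.1.4]'s content; PREP-IV4c3 §3), which is NOT proved here.

Nothing of [Liu2021] / [GR90] is asserted: twist rigidity enters only as the HYPOTHESIS `h` of §3 (an explicit `∀`-statement,
no new named fact).  HC_CM is proved only modulo the 7 printed citations until rung 0 of the ladder closes.

## References
* [Liu2021] Y. Liu, Camb. J. Math. 9 (2021) = arXiv:2102.11518 — App. D Lem. D.1 (3) (l. 5233) and proof l. 5255.
* [GelbartRogawski1991] S. Gelbart, J. Rogawski, Invent. Math. 105 (1991), §3.1 Remark p. 457 (compatible splittings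
  differ by characters of the centre).
* [MoeglinVignerasWaldspurger1987] MVW, LNM 1291, Chap. 2 II.1 (B), II.8; Chap. 3 §IV.
-/

noncomputable section

/-! ## §1 Generic: coinvariants of a twist -/

namespace Literature.RepresentationTheory.TwistedCoinv

variable {k : Type*} [Field k] {G H S : Type*} [Group G] [Group H] [AddCommGroup S] [Module k S]

/-- **Coinvariants of a twist.**  Two acting pairs `(ρV, ρW)`, `(ρV′, ρW′)` on ONE module `S` that differ by scalars —
`ρW′ h = e h • ρW h`, `ρV′ g = η g • ρV g` — have, for characters with `χ′ = e · χ`, canonically isomorphic coinvariants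
`Coinv ρW χ ≃ Coinv ρW′ χ′` (`[v] ↦ [v]`, the relation submodules being EQUAL), and the isomorphism carries the twist
`η ⊗ rep χ ρV` to `rep χ′ ρV′`: **`Θ_{η·s}(χ · η_Z) ≅ η ⊗ Θ_s(χ)`** for a dual-pair splitting `s` twisted by a central
character `η` (`η_Z` its restriction to the small member). [cite: GelbartRogawski1991, §3.1 Remark p. 457 L4–13]
[cite: MoeglinVignerasWaldspurger1987, Chap. 2 II.1 (B)] -/
theorem exists_linearEquiv_of_twist (ρW ρW' : Representation k H S) (χ χ' : H →* kˣ) (ρV ρV' : Representation k G S)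
    (hc : ∀ (g : G) (h : H), Commute (ρV g) (ρW h)) (hc' : ∀ (g : G) (h : H), Commute (ρV' g) (ρW' h))
    (e : H → kˣ) (η : G →* kˣ) (hρ : ∀ (h : H) (v : S), ρW' h v = ((e h : kˣ) : k) • ρW h v)
    (hχ : ∀ h : H, χ' h = e h * χ h) (hV : ∀ (g : G) (v : S), ρV' g v = ((η g : kˣ) : k) • ρV g v) :
    ∃ f : Coinv ρW χ ≃ₗ[k] Coinv ρW' χ',
      (∀ v : S, f (mk ρW χ v) = mk ρW' χ' v) ∧
      ∀ (g : G) (x : Coinv ρW χ), f (SeesawScalar.twist η (rep χ ρV hc) g x) = rep χ' ρV' hc' g (f x) := by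
  have hT : ∀ (h : H) (v : S), ρW' h (LinearEquiv.refl k S v) = ((e h : kˣ) : k) • LinearEquiv.refl k S (ρW h v) :=
    fun h v => hρ h v
  refine ⟨mapEquiv ρW χ ρW' χ' (LinearEquiv.refl k S) e hT hχ, fun v => rfl, fun g x => ?_⟩
  rw [SeesawScalar.twist_apply, map_smul]
  exact (mapEquiv_rep ρW χ ρW' χ' ρV ρV' hc hc' (LinearEquiv.refl k S) e hT hχ (g := g) (g' := g)
    (a := ((η g : kˣ) : k)) (fun v => hV g v) x).symm

end Literature.RepresentationTheory.TwistedCoinv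

/-! ## §2–§3 The rank-one theta lift: reduction of twist rigidity for two splittings to one splitting and a twist -/

namespace Literature.RepresentationTheory.MoeglinVignerasWaldspurger1987

open NumberField IsDedekindDomain
open scoped Matrix
open Literature.RepresentationTheory (SeesawScalar.twist SeesawScalar.twist_apply)
open Literature.RepresentationTheory.HeisenbergGroup
open Literature.NumberTheory.GelbartRogawski1991.UnitaryDualPair.LocalSplitting
open Literature.NumberTheory.Automorphic
open Literature.NumberTheory.Automorphic.UnitaryGroup
open Literature.NumberTheory.Automorphic.Liu2021

/-- A homomorphism into `ℂˣ` with open kernel is continuous (it is constant on the cosets of its kernel). [folklore] -/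
private theorem continuous_of_isOpen_ker' {Γ : Type*} [Group Γ] [TopologicalSpace Γ] [IsTopologicalGroup Γ]
    (ψ : Γ →* ℂˣ) (hψ : IsOpen ((ψ.ker : Subgroup Γ) : Set Γ)) : Continuous ψ := by
  refine (IsLocallyConstant.iff_exists_open _).2 (fun γ => ?_) |>.continuous
  refine ⟨(fun κ => γ * κ) '' (ψ.ker : Set Γ), (isOpenMap_mul_left γ) _ hψ, ⟨1, ψ.ker.one_mem, mul_one γ⟩, ?_⟩
  rintro _ ⟨κ, hκ, rfl⟩
  rw [map_mul, (MonoidHom.mem_ker).1 hκ, mul_one]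

/-- A continuous `ℂˣ`-valued character of a compact group is unitary. [folklore] -/
private theorem norm_apply_eq_one_of_compactSpace' {Γ : Type*} [Group Γ] [TopologicalSpace Γ] [CompactSpace Γ]
    (ψ : Γ →* ℂˣ) (hψ : Continuous ψ) (γ : Γ) : ‖((ψ γ : ℂˣ) : ℂ)‖ = 1 := by
  have hc : Continuous fun τ : Γ => ‖((ψ τ : ℂˣ) : ℂ)‖ :=
    continuous_norm.comp (Units.continuous_val.comp hψ)
  obtain ⟨M, hM⟩ := (isCompact_range hc).isBounded.bddAbove
  have hle : ∀ τ : Γ, ‖((ψ τ : ℂˣ) : ℂ)‖ ≤ 1 := fun τ => not_lt.mp fun hlt => by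
    obtain ⟨m, hm⟩ := pow_unbounded_of_one_lt M hlt
    have hm' : ‖((ψ τ : ℂˣ) : ℂ)‖ ^ m ≤ M := by
      have h := hM (Set.mem_range_self (τ ^ m))
      simpa only [map_pow, Units.val_pow_eq_pow_val, norm_pow] using h
    exact absurd hm' (not_le.mpr hm)
  refine le_antisymm (hle γ) ?_
  have h1 := hle γ⁻¹
  rw [map_inv, Units.val_inv_eq_inv_val, norm_inv] at h1
  exact (inv_le_one₀ (norm_pos_iff.mpr (Units.ne_zero _))).mp h1

/-- Two homomorphisms into `S̃p_ψ` differing by the TRIVIAL character are equal: `s′ g = i(η g) · s g` with `η = 1`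
gives `s = s′` (stated for an abstract Heisenberg representation `ρ`, so that no concrete model is unfolded).
[cite: MoeglinVignerasWaldspurger1987, Chap. 2 II.1 (B)] -/
theorem MpPsi.eq_of_forall_eq_ofScalar_mul_of_eq_one {R : Type*} [CommRing R] [Invertible (2 : R)] {V : Type*}
    [AddCommGroup V] [Module R V] {B : V →ₗ[R] V →ₗ[R] R} {k : Type*} [Field k] {S : Type*} [AddCommGroup S] [Module k S]
    (ρ : Representation k (Heisenberg B) S) {G : Type*} [Group G] (s s' : G →* MpPsi ρ) (η : G →* kˣ)
    (hη : ∀ g, s' g = MpPsi.ofScalar ρ (η g) * s g) (h1 : η = 1) : s = s' := by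
  subst h1
  refine MonoidHom.ext fun g => ?_
  rw [hη g, MonoidHom.one_apply, map_one, one_mul]

/-- If `s′ g = i(η g) · s g` in `S̃p_ψ` then the Weil representations along `s′` and `s` differ by the scalar `η g`:
`ω_{s′}(g) f = η g • ω_s(g) f` (abstract Heisenberg representation `ρ`; the computation of
`MpPsi.exists_twist_toRep_comp_of_proj_eq`). [cite: MoeglinVignerasWaldspurger1987, Chap. 2 II.1 (B)] -/
theorem MpPsi.toRep_comp_apply_of_forall_eq_ofScalar_mul {R : Type*} [CommRing R] [Invertible (2 : R)] {V : Type*}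
    [AddCommGroup V] [Module R V] {B : V →ₗ[R] V →ₗ[R] R} {k : Type*} [Field k] {S : Type*} [AddCommGroup S] [Module k S]
    (ρ : Representation k (Heisenberg B) S) {G : Type*} [Group G] (s s' : G →* MpPsi ρ) (η : G →* kˣ)
    (hη : ∀ g, s' g = MpPsi.ofScalar ρ (η g) * s g) (g : G) (f : S) :
    (MpPsi.toRep ρ).comp s' g f = ((η g : kˣ) : k) • (MpPsi.toRep ρ).comp s g f := by
  rw [MonoidHom.comp_apply, MonoidHom.comp_apply, MpPsi.toRep_apply, MpPsi.toRep_apply, hη g, Subgroup.coe_mul,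
    Prod.snd_mul, LinearEquiv.mul_apply, MpPsi.coe_ofScalar, scalarOp_apply]

/-- **The coinvariant representation depends only on `ω`**: for `ω = ω′` (an EQUATION between representations of
`U(J)(F_v)` on one space, e.g. `ω_{s₂} = η • ω_{s₁}`), the `χ`-coinvariant representations under a homomorphism `ζ` into
`U(J)(F_v)` are isomorphic (transport of structure). [cite: GelbartRogawski1991, §3.1 Remark p. 457 L4–13] -/
theorem areIsomorphicRep_rep_of_eq {G H S : Type*} [Group G] [Group H] [AddCommGroup S] [Module ℂ S]
    (ζ : H →* G) (ω ω' : Representation ℂ G S) (hω : ω = ω') (χ : H →* ℂˣ)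
    (hc : ∀ (g : G) (h : H), Commute (ω g) ((ω.comp ζ) h)) (hc' : ∀ (g : G) (h : H), Commute (ω' g) ((ω'.comp ζ) h)) :
    AreIsomorphicRep (TwistedCoinv.rep (ρW := ω.comp ζ) χ ω hc) (TwistedCoinv.rep (ρW := ω'.comp ζ) χ ω' hc') := by
  subst hω
  exact AreIsomorphicRep.refl _

-- thirty-binder statement and context (the fact's `show … from` ascriptions reproduced verbatim); about 2× the default budget
set_option maxHeartbeats 400000 in
/-- **Row IV-4c3 reduces to twist rigidity for ONE splitting.**  If for every splitting `s` of `U(J)(F_v)` over `ι`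
(`ω_s` smooth), every character `η : U(J)(F_v) → ℂˣ` with OPEN kernel and all unitary continuous characters `χ, χ′` of the
centre `U(J₁)(F_v)`, the conditions `Θ_s(χ) ≠ 0` and `Θ_s(χ) ≅ η ⊗ Θ_s(χ′)` force `η = 1` — TWIST RIGIDITY of the rank-one
theta lift to `U(3)`, the content of [GelbartRogawski1990, Prop. 5.1.4] — then the named fact `rankOne_theta_twist_rigidity`
(`Θ_{s₁}(χ₁) ≅ Θ_{s₂}(χ₂) ≠ 0 ⇒ s₁ = s₂`) holds: `s₂ = η • s₁` for a character `η` with open kernel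
(`MpPsi.exists_character_of_proj_eq`, `isOpen_ker_of_twist_of_isSmoothVector`), `Θ_{s₂}(χ₂) ≅ η ⊗ Θ_{s₁}(χ₂ · η_Z⁻¹)` (§1) with
`η_Z = η ∘ localCenter` unitary (compact centre at a non-split place) and continuous, so the hypothesis applies with
`χ := χ₁`, `χ′ := χ₂ · η_Z⁻¹`. [cite: Liu2021, App. D Lemma D.1 (3) (l. 5233) and proof l. 5255]
[cite: GelbartRogawski1991, §3.1 Remark p. 457 L4–13] -/
theorem rankOne_theta_twist_rigidity_of_twistRigid
    (h : ∀ (F : Type) [Field F] [NumberField F] (E : Type) [Field E] [NumberField E] [Algebra F E]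
      [Algebra.IsQuadraticExtension F E] (c : E ≃ₐ[F] E) (δ : E) (hcδ : c δ = -δ) (hδ : δ ≠ 0) (d : F)
      (hd : δ * δ = algebraMap F E d) (T : Matrix (Fin 3) (Fin 3) F) (hT : T.IsSymm) (_hTd : IsUnit T.det)
      (J : Matrix (Fin 3) (Fin 3) E) (hJ : J = T.map (algebraMap F E)) (v : HeightOneSpectrum (𝓞 F))
      (_hE : IsField (UnitaryGroup.LocalRing E v))
      (s : localPi E c 3 J v →* LocalMp F 3 T v)
      (_hs : ∀ g, MpPsi.proj _ (s g) = iota F E c 3 hcδ hδ hd T hT hJ v g)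
      (_hsm : Representation.IsSmooth ((MpPsi.toRep (localSchrodinger F 3 T v)).comp s))
      (η : localPi E c 3 J v →* ℂˣ) (_hη : IsOpen ((η.ker : Subgroup (localPi E c 3 J v)) : Set (localPi E c 3 J v)))
      (J₁ : Matrix (Fin 1) (Fin 1) E) (hJ₁ : J₁ 0 0 ≠ 0) (χ χ' : localPi E c 1 J₁ v →* ℂˣ)
      (_hχu : ∀ z, ‖((χ z : ℂˣ) : ℂ)‖ = 1) (_hχc : Continuous fun z => ((χ z : ℂˣ) : ℂ))
      (_hχ'u : ∀ z, ‖((χ' z : ℂˣ) : ℂ)‖ = 1) (_hχ'c : Continuous fun z => ((χ' z : ℂˣ) : ℂ))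
      (_hnt : Nontrivial (TwistedCoinv.Coinv
        ((show Representation ℂ (localPi E c 1 J₁ v) (SchwartzBruhat (Fin 3 → v.adicCompletion F)) from
          ((MpPsi.toRep (localSchrodinger F 3 T v)).comp s).comp (localCenter E c 3 J J₁ hJ₁ v))) χ))
      (_hiso : AreIsomorphicRep
        (TwistedCoinv.rep
          (ρW := show Representation ℂ (localPi E c 1 J₁ v) (SchwartzBruhat (Fin 3 → v.adicCompletion F)) from
            ((MpPsi.toRep (localSchrodinger F 3 T v)).comp s).comp (localCenter E c 3 J J₁ hJ₁ v))
          χ ((MpPsi.toRep (localSchrodinger F 3 T v)).comp s)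
          (fun g z => (show Commute g (localCenter E c 3 J J₁ hJ₁ v z) from
            localCenter_comm E c 3 J J₁ hJ₁ v z g).map ((MpPsi.toRep (localSchrodinger F 3 T v)).comp s)))
        (SeesawScalar.twist η (TwistedCoinv.rep
          (ρW := show Representation ℂ (localPi E c 1 J₁ v) (SchwartzBruhat (Fin 3 → v.adicCompletion F)) from
            ((MpPsi.toRep (localSchrodinger F 3 T v)).comp s).comp (localCenter E c 3 J J₁ hJ₁ v))
          χ' ((MpPsi.toRep (localSchrodinger F 3 T v)).comp s)
          (fun g z => (show Commute g (localCenter E c 3 J J₁ hJ₁ v z) from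
            localCenter_comm E c 3 J J₁ hJ₁ v z g).map ((MpPsi.toRep (localSchrodinger F 3 T v)).comp s))))),
      η = 1) :
    rankOne_theta_twist_rigidity := by
  intro F _ _ E _ _ _ _ c δ hcδ hδ d hd T hT hTd J hJ v hE s₁ s₂ hs₁ hs₂ hsm₁ hsm₂ J₁ hJ₁ χ₁ χ₂ hχ₁u hχ₁c hχ₂u hχ₂c
    hnt hiso
  classical
  /- §0 the non-split place: `c ≠ 1`, the unique place `w`, compact centre -/
  have hc1 : c ≠ 1 := by
    rintro rfl
    exact hδ (self_eq_neg.1 (by simpa only [AlgEquiv.one_apply] using hcδ))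
  obtain ⟨w⟩ := (inferInstance : Nonempty (PlacesOver E v))
  have hw : c • w.1 = w.1 := by
    by_contra hw
    exact LemD1IndexedNonVacuityAtPlace.not_isField_localRing_of_split E v c w hw hE
  haveI : CompactSpace (localPi E c 1 J₁ v) := compactSpace_localPi_one_of_smul_eq c J₁ hc1 hJ₁ w hw
  /- §1 the two splittings differ by a character `η` with open kernel -/
  obtain ⟨η, hη⟩ := MpPsi.exists_character_of_proj_eq (localSchrodinger F 3 T v)
    (implementerUniqueUpToScalar_localSchrodinger F 3 T hTd v) s₁ s₂ (fun g => by rw [hs₁, hs₂])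
  have hωη : ∀ (g : localPi E c 3 J v) (f : SchwartzBruhat (Fin 3 → v.adicCompletion F)),
      ((MpPsi.toRep (localSchrodinger F 3 T v)).comp s₂) g f =
        ((η g : ℂˣ) : ℂ) • ((MpPsi.toRep (localSchrodinger F 3 T v)).comp s₁) g f :=
    MpPsi.toRep_comp_apply_of_forall_eq_ofScalar_mul (localSchrodinger F 3 T v) s₁ s₂ η hη
  have hω : ((MpPsi.toRep (localSchrodinger F 3 T v)).comp s₂) = SeesawScalar.twist η ((MpPsi.toRep (localSchrodinger F 3 T v)).comp s₁) :=
    MonoidHom.ext fun g => LinearMap.ext fun f => by rw [SeesawScalar.twist_apply, hωη]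
  obtain ⟨Φ₀, hΦ₀⟩ := exists_ne (0 : SchwartzBruhat (Fin 3 → v.adicCompletion F))
  have hηo : IsOpen ((η.ker : Subgroup (localPi E c 3 J v)) : Set (localPi E c 3 J v)) :=
    isOpen_ker_of_twist_of_isSmoothVector ((MpPsi.toRep (localSchrodinger F 3 T v)).comp s₁)
        ((MpPsi.toRep (localSchrodinger F 3 T v)).comp s₂) η hωη hΦ₀ (hsm₁ Φ₀) (hsm₂ Φ₀)
  /- §2 the central restriction `η_Z` is unitary and continuous; `χ′ := χ₂ · η_Z⁻¹` -/
  -- (`obtain … rfl` keeps the new names opaque: `set` would search the thirty-binder context and time out)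
  obtain ⟨ηZ, hηZ⟩ : ∃ ηZ : localPi E c 1 J₁ v →* ℂˣ, ηZ = η.comp (localCenter E c 3 J J₁ hJ₁ v) := ⟨_, rfl⟩
  have hηZ_apply : ∀ z, ηZ z = η (localCenter E c 3 J J₁ hJ₁ v z) := fun z => by rw [hηZ, MonoidHom.comp_apply]
  have hηZo : IsOpen ((ηZ.ker : Subgroup (localPi E c 1 J₁ v)) : Set (localPi E c 1 J₁ v)) := by
    have hpre : ((ηZ.ker : Subgroup (localPi E c 1 J₁ v)) : Set (localPi E c 1 J₁ v)) =
        (localCenter E c 3 J J₁ hJ₁ v) ⁻¹' ((η.ker : Subgroup (localPi E c 3 J v)) : Set (localPi E c 3 J v)) := by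
      ext z
      rw [SetLike.mem_coe, MonoidHom.mem_ker, Set.mem_preimage, SetLike.mem_coe, MonoidHom.mem_ker, hηZ_apply]
    rw [hpre]
    exact hηo.preimage (continuous_localCenter E c 3 J J₁ hJ₁ v)
  have hηZc : Continuous ηZ := continuous_of_isOpen_ker' ηZ hηZo
  have hηZu : ∀ z, ‖((ηZ z : ℂˣ) : ℂ)‖ = 1 := norm_apply_eq_one_of_compactSpace' ηZ hηZc
  obtain ⟨χ', hχ'⟩ : ∃ χ' : localPi E c 1 J₁ v →* ℂˣ, χ' = χ₂ * ηZ⁻¹ := ⟨_, rfl⟩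
  have hχ'_apply : ∀ z, χ' z = χ₂ z * (ηZ z)⁻¹ := fun z => by rw [hχ', MonoidHom.mul_apply, MonoidHom.inv_apply]
  have hχ'u : ∀ z, ‖((χ' z : ℂˣ) : ℂ)‖ = 1 := fun z => by
    rw [hχ'_apply, Units.val_mul, norm_mul, hχ₂u, Units.val_inv_eq_inv_val, norm_inv, hηZu, inv_one, mul_one]
  have hχ'c : Continuous fun z => ((χ' z : ℂˣ) : ℂ) := by
    have h1 : Continuous fun z => ((ηZ z : ℂˣ) : ℂ)⁻¹ :=
      (Units.continuous_val.comp hηZc).inv₀ fun z => Units.ne_zero _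
    have h2 : (fun z => ((χ' z : ℂˣ) : ℂ)) = fun z => ((χ₂ z : ℂˣ) : ℂ) * ((ηZ z : ℂˣ) : ℂ)⁻¹ := by
      funext z
      rw [hχ'_apply, Units.val_mul, Units.val_inv_eq_inv_val]
    rw [h2]
    exact hχ₂c.mul h1
  /- §3 `Θ_{s₂}(χ₂) ≅ η ⊗ Θ_{s₁}(χ′)` -/
  have hcomm₁ : ∀ (g : localPi E c 3 J v) (z : localPi E c 1 J₁ v),
      Commute (((MpPsi.toRep (localSchrodinger F 3 T v)).comp s₁) g) ((
          ((MpPsi.toRep (localSchrodinger F 3 T v)).comp s₁).comp (localCenter E c 3 J J₁ hJ₁ v)) z) :=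
    fun g z => (show Commute g (localCenter E c 3 J J₁ hJ₁ v z) from localCenter_comm E c 3 J J₁ hJ₁ v z g).map ((MpPsi.toRep (localSchrodinger F 3 T v)).comp s₁)
  have hcomm₂ : ∀ (g : localPi E c 3 J v) (z : localPi E c 1 J₁ v),
      Commute (((MpPsi.toRep (localSchrodinger F 3 T v)).comp s₂) g) ((
          ((MpPsi.toRep (localSchrodinger F 3 T v)).comp s₂).comp (localCenter E c 3 J J₁ hJ₁ v)) z) :=
    fun g z => (show Commute g (localCenter E c 3 J J₁ hJ₁ v z) from localCenter_comm E c 3 J J₁ hJ₁ v z g).map ((MpPsi.toRep (localSchrodinger F 3 T v)).comp s₂)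
  have hcommη : ∀ (g : localPi E c 3 J v) (z : localPi E c 1 J₁ v),
      Commute (SeesawScalar.twist η ((MpPsi.toRep (localSchrodinger F 3 T v)).comp s₁) g) (((SeesawScalar.twist η
          ((MpPsi.toRep (localSchrodinger F 3 T v)).comp s₁)).comp (localCenter E c 3 J J₁ hJ₁ v)) z) :=
    fun g z => (show Commute g (localCenter E c 3 J J₁ hJ₁ v z) from
      localCenter_comm E c 3 J J₁ hJ₁ v z g).map (SeesawScalar.twist η ((MpPsi.toRep (localSchrodinger F 3 T v)).comp s₁))
  -- (B) transport along `((MpPsi.toRep (localSchrodinger F 3 T v)).comp s₂) = η • ((MpPsi.toRep (localSchrodinger F 3 T v)).comp s₁)`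
  have hB : AreIsomorphicRep (TwistedCoinv.rep (ρW := ((MpPsi.toRep (localSchrodinger F 3 T v)).comp s₂).comp (localCenter E c 3 J J₁ hJ₁ v)) χ₂
      ((MpPsi.toRep (localSchrodinger F 3 T v)).comp s₂) hcomm₂)
      (TwistedCoinv.rep (ρW := (SeesawScalar.twist η ((MpPsi.toRep (localSchrodinger F 3 T v)).comp s₁)).comp (localCenter E c 3 J J₁ hJ₁ v)) χ₂
        (SeesawScalar.twist η ((MpPsi.toRep (localSchrodinger F 3 T v)).comp s₁)) hcommη) :=
    areIsomorphicRep_rep_of_eq (localCenter E c 3 J J₁ hJ₁ v) ((MpPsi.toRep (localSchrodinger F 3 T v)).comp s₂) (SeesawScalar.twist η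
        ((MpPsi.toRep (localSchrodinger F 3 T v)).comp s₁)) hω χ₂ hcomm₂ hcommη
  -- (C) coinvariants of the twist: `η ⊗ Θ_{s₁}(χ′) ≅ rep χ₂ (η • ((MpPsi.toRep (localSchrodinger F 3 T v)).comp s₁))`
  obtain ⟨f, -, hf⟩ := TwistedCoinv.exists_linearEquiv_of_twist
    (((MpPsi.toRep (localSchrodinger F 3 T v)).comp s₁).comp (localCenter E c 3 J J₁ hJ₁ v)) ((SeesawScalar.twist η
        ((MpPsi.toRep (localSchrodinger F 3 T v)).comp s₁)).comp (localCenter E c 3 J J₁ hJ₁ v)) χ' χ₂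
    ((MpPsi.toRep (localSchrodinger F 3 T v)).comp s₁) (SeesawScalar.twist η ((MpPsi.toRep (localSchrodinger F 3 T v)).comp s₁)) hcomm₁ hcommη ηZ η
    (fun z f => by rw [MonoidHom.comp_apply, MonoidHom.comp_apply, SeesawScalar.twist_apply, hηZ_apply])
    (fun z => by rw [hχ'_apply, mul_comm (χ₂ z), ← mul_assoc, mul_inv_cancel, one_mul])
    (fun g f => by rw [SeesawScalar.twist_apply])
  have hC : AreIsomorphicRep
      (SeesawScalar.twist η (TwistedCoinv.rep (ρW := ((MpPsi.toRep (localSchrodinger F 3 T v)).comp s₁).comp (localCenter E c 3 J J₁ hJ₁ v)) χ'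
          ((MpPsi.toRep (localSchrodinger F 3 T v)).comp s₁) hcomm₁))
      (TwistedCoinv.rep (ρW := (SeesawScalar.twist η ((MpPsi.toRep (localSchrodinger F 3 T v)).comp s₁)).comp (localCenter E c 3 J J₁ hJ₁ v)) χ₂
        (SeesawScalar.twist η ((MpPsi.toRep (localSchrodinger F 3 T v)).comp s₁)) hcommη) :=
    ⟨f, hf⟩
  -- the chain `Θ_{s₁}(χ₁) ≅ Θ_{s₂}(χ₂) ≅ rep χ₂ (η • ((MpPsi.toRep (localSchrodinger F 3 T v)).comp s₁)) ≅ η ⊗ Θ_{s₁}(χ′)`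
  have hchain : AreIsomorphicRep (TwistedCoinv.rep (ρW := ((MpPsi.toRep (localSchrodinger F 3 T v)).comp s₁).comp (localCenter E c 3 J J₁ hJ₁ v)) χ₁
      ((MpPsi.toRep (localSchrodinger F 3 T v)).comp s₁) hcomm₁)
      (SeesawScalar.twist η (TwistedCoinv.rep (ρW := ((MpPsi.toRep (localSchrodinger F 3 T v)).comp s₁).comp (localCenter E c 3 J J₁ hJ₁ v)) χ'
          ((MpPsi.toRep (localSchrodinger F 3 T v)).comp s₁) hcomm₁)) :=
    (hiso.trans hB).trans hC.symm
  /- §4 twist rigidity for `s₁` gives `η = 1`, hence `s₂ = s₁` -/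
  have hη1 : η = 1 :=
    h F E c δ hcδ hδ d hd T hT hTd J hJ v hE s₁ hs₁ hsm₁ η hηo J₁ hJ₁ χ₁ χ' hχ₁u hχ₁c hχ'u hχ'c hnt hchain
  exact MpPsi.eq_of_forall_eq_ofScalar_mul_of_eq_one (localSchrodinger F 3 T v) s₁ s₂ η hη hη1

end Literature.RepresentationTheory.MoeglinVignerasWaldspurger1987

end
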